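import Mathlib
import Literature.NumberTheory.Transcendental.SemialgebraicAlgebraicPoints
import Literature.NumberTheory.Transcendental.KZSemialgebraicComplex
import Summits.KontsevichZagierPeriods.KontsevichZagierPeriods.Theorems.InverseLandauTateFamilyKernelOpenCube

/-!
# `TateLifting` (stmt-KontsevichZagierPeriods-9129), line `Sketch` — stub `stub_intervalPolyPoint`

POLYNOMIAL INTERVAL TO A POINT. Let `K = algebraicClosure ℚ ℝ` be the field of real algebraic
numbers and `P ∈ K[z₀]` (an `MvPolynomial (Fin 1) K`). Every honest representation `ρ` of the
Kontsevich–Zagier calculus with domain the open interval `(0,1)` (spelled `Set.pi univ (0,1)`) and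
integrand `= P` there differs by relations from a representation `r₀` over the point `ℝ⁰`
(domain `Set.univ`), namely the tame cube `[[0,1]⁰, G(1) − G(0)]` for a polynomial primitive
`G ∈ K[z₀]`, `∂₀ G = P`:

* `[[0,1]¹, P] − [ρ] ∈ relations` — open versus closed interval across the two null end points
  (`TateFamilyKernel.of_sub_of_mem_relations_of_domain_eq_cube`);
* `[[0,1]¹, P] − [[0,1]⁰, G(1) − G(0)] ∈ KZ.cubicalStokesGens ⊆ relations` — ONE Newton–Leibniz
  move along the only coordinate with the primitive `G` (`KZ.mem_cubicalStokesGens`, `n = 0`).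

Tameness (analyticity near the closed cube, `ℚ`-semialgebraicity on it) of `z ↦ P(z)` and
`z ↦ G(z)` is taken from the HYPOTHESIS of the stub (the registered statement `CylinderTame`,
instantiated at `n = 0`, `q = 1`); the constant `G(1) − G(0)` is real-algebraic as the difference of
two values of a `ℚ`-semialgebraic function at rational points
(`IsSemialgebraicFunOn.isAlgebraic_apply`), hence a `ℚ`-semialgebraic constant function on `[0,1]⁰`
(`isSemialgebraicFunOn_const_of_isAlgebraic`).

References: M. Kontsevich, D. Zagier, *Periods* (2001), §1.2, rules (1) and (3).
-/

noncomputable section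

open MeasureTheory Set MvPolynomial
open Literature.NumberTheory.Transcendental

namespace Summit.KontsevichZagierPeriods.InverseLandau

namespace IntervalPoly

/-! ### Polynomial primitives and derivatives along the single coordinate -/

/-- Every polynomial over a field of characteristic zero has a polynomial primitive along a given
variable: `∃ G, ∂ᵢ G = p` (integrate each monomial). [folklore] -/
theorem exists_pderiv_eq {K : Type*} [Field K] [CharZero K] {M : ℕ} (i : Fin M)
    (p : MvPolynomial (Fin M) K) : ∃ G : MvPolynomial (Fin M) K, pderiv i G = p := by
  -- adapted from `KZ.exists_pderiv_eq` (KZCubePolynomialKernel.lean), `ℚ` replaced by `K`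
  induction p using MvPolynomial.induction_on' with
  | monomial s a =>
    refine ⟨monomial (s + Finsupp.single i 1) (a / ((s i : K) + 1)), ?_⟩
    rw [pderiv_monomial]
    simp only [add_tsub_cancel_right, Finsupp.coe_add, Pi.add_apply, Finsupp.single_eq_same,
      Nat.cast_add, Nat.cast_one]
    congr 1
    have : ((s i : K) + 1) ≠ 0 := Nat.cast_add_one_ne_zero _
    field_simp
  | add p q hp hq =>
    obtain ⟨G, hG⟩ := hp
    obtain ⟨H, hH⟩ := hq
    exact ⟨G + H, by rw [map_add, hG, hH]⟩

/-- Chain rule for `aeval` of a polynomial with real-algebraic coefficients along a real path.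
[folklore] -/
theorem hasDerivAt_aeval_comp {N : ℕ} {γ : ℝ → (Fin N → ℝ)} {γ' : Fin N → ℝ} {t : ℝ}
    (hγ : ∀ i, HasDerivAt (fun u => γ u i) (γ' i) t)
    (P : MvPolynomial (Fin N) (algebraicClosure ℚ ℝ)) :
    HasDerivAt (fun u => (aeval (γ u) P : ℝ)) (∑ i, aeval (γ t) (pderiv i P) * γ' i) t := by
  -- adapted from `KZ.hasDerivAt_aeval_comp_real` (KZCubeRational.lean), `ℚ` replaced by `K`
  induction P using MvPolynomial.induction_on with
  | C a =>
    simp only [aeval_C, pderiv_C, map_zero, zero_mul, Finset.sum_const_zero]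
    exact hasDerivAt_const t _
  | add p q hp hq =>
    have h := hp.add hq
    simp only [map_add, add_mul, Finset.sum_add_distrib]
    exact h
  | mul_X p i hp =>
    have h := hp.mul (hγ i)
    have key : ∀ k, (aeval (γ t) (pderiv k (p * X i)) : ℝ) * γ' k =
        aeval (γ t) (pderiv k p) * γ' k * γ t i +
          (if k = i then aeval (γ t) p * γ' i else 0) := by
      intro k
      rw [pderiv_mul, map_add, map_mul, map_mul, aeval_X]
      by_cases hk : k = i
      · subst hk
        rw [pderiv_X_self, map_one, if_pos rfl]
        ring
      · rw [pderiv_X_of_ne (fun h => hk h.symm), map_zero, if_neg hk]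
        ring
    have hsum : (∑ k, (aeval (γ t) (pderiv k (p * X i)) : ℝ) * γ' k) =
        (∑ k, aeval (γ t) (pderiv k p) * γ' k) * γ t i + aeval (γ t) p * γ' i := by
      rw [Finset.sum_congr rfl fun k _ => key k, Finset.sum_add_distrib, Finset.sum_mul,
        Finset.sum_ite_eq' Finset.univ i, if_pos (Finset.mem_univ _)]
    rw [hsum]
    have hfun : (fun u => (aeval (γ u) (p * X i) : ℝ)) = fun u => aeval (γ u) p * γ u i := by
      funext u
      rw [map_mul, aeval_X]
    rw [hfun]
    exact h

/-- Derivative of a one-variable polynomial with real-algebraic coefficients, read as an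
`MvPolynomial (Fin 1)`: `d/ds G(s) = (∂₀ G)(s)`. [folklore] -/
theorem hasDerivAt_aeval_const (G : MvPolynomial (Fin 1) (algebraicClosure ℚ ℝ)) (t : ℝ) :
    HasDerivAt (fun s : ℝ => (aeval (fun _ : Fin 1 => s) G : ℝ))
      (aeval (fun _ : Fin 1 => t) (pderiv 0 G)) t := by
  have hγ : ∀ i : Fin 1,
      HasDerivAt (fun u : ℝ => (fun _ : Fin 1 => u) i) ((fun _ => (1 : ℝ)) i) t :=
    fun _ => hasDerivAt_id t
  have h := hasDerivAt_aeval_comp hγ G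
  simpa [Fin.sum_univ_one] using h

/-- The constant point `(c, …, c)` with `0 ≤ c ≤ 1` lies in the closed unit cube. [folklore] -/
theorem const_mem_cube {n : ℕ} {c : ℝ} (h0 : 0 ≤ c) (h1 : c ≤ 1) :
    (fun _ : Fin n => c) ∈ KZ.cube n := fun _ => ⟨h0, h1⟩

end IntervalPoly

/-- **Polynomial interval to a point** (stub `stub_intervalPolyPoint` of the lead's skeleton, the
implication `CylinderTame → IntervalPolyPoint` unfolded): for `P ∈ K[z₀]`, `K` the real algebraic
numbers, every representation `ρ` over the open interval `(0,1)` with integrand `P` differs by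
relations of the Kontsevich–Zagier calculus from a representation over the point `ℝ⁰` — the tame
cube `[pt, G(1) − G(0)]` for a polynomial primitive `∂₀G = P` (open ↔ closed interval across the
two null end points, then one Newton–Leibniz move along the only coordinate).
[cite: KontsevichZagier2001, §1.2] -/
theorem tateLifting_intervalPolyPoint :
    (∀ (n : ℕ) (P : MvPolynomial (Fin (n + 1)) (algebraicClosure ℚ ℝ))
      (q : Polynomial (algebraicClosure ℚ ℝ)),
      (∀ t ∈ Set.Icc (0 : ℝ) 1, Polynomial.aeval t q ≠ 0) →
      AnalyticOnNhd ℝ (fun z : Fin (n + 1) → ℝ => MvPolynomial.aeval z P / Polynomial.aeval (z 0) q)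
          (KZ.cube (n + 1)) ∧
        IsSemialgebraicFunOn ℚ (KZ.cube (n + 1))
          (fun z : Fin (n + 1) → ℝ => MvPolynomial.aeval z P / Polynomial.aeval (z 0) q)) →
    ∀ (P : MvPolynomial (Fin 1) (algebraicClosure ℚ ℝ)) (ρ : KZ.IntegralRep 1),
      ρ.domain = Set.pi Set.univ (fun _ => Set.Ioo (0 : ℝ) 1) →
      Set.EqOn ρ.integrand (fun z => MvPolynomial.aeval z P) ρ.domain →
      ∃ r₀ : KZ.IntegralRep 0, r₀.domain = Set.univ ∧ KZ.of ρ - KZ.of r₀ ∈ KZ.relations := by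
  intro hT P ρ hd hi
  -- tameness of `z ↦ Q(z)` for every `Q ∈ K[z₀]`, from the hypothesis with `n = 0`, `q = 1`
  have tame : ∀ Q : MvPolynomial (Fin 1) (algebraicClosure ℚ ℝ),
      AnalyticOnNhd ℝ (fun z : Fin 1 → ℝ => (aeval z Q : ℝ)) (KZ.cube 1) ∧
        IsSemialgebraicFunOn ℚ (KZ.cube 1) (fun z : Fin 1 → ℝ => (aeval z Q : ℝ)) := by
    intro Q
    have h1 : ∀ t ∈ Set.Icc (0 : ℝ) 1,
        Polynomial.aeval t (1 : Polynomial (algebraicClosure ℚ ℝ)) ≠ 0 :=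
      fun t _ => by rw [map_one]; exact one_ne_zero
    have hfun : (fun z : Fin (0 + 1) → ℝ => (MvPolynomial.aeval z Q : ℝ) /
        Polynomial.aeval (z 0) (1 : Polynomial (algebraicClosure ℚ ℝ))) =
        fun z => (aeval z Q : ℝ) := by
      funext z
      rw [map_one, div_one]
    have h := hT 0 Q 1 h1
    rw [hfun] at h
    exact h
  -- the polynomial primitive along the only coordinate
  obtain ⟨G, hG⟩ := IntervalPoly.exists_pderiv_eq (0 : Fin 1) P
  obtain ⟨hfa, hfs⟩ := tame P
  obtain ⟨hFa, hFs⟩ := tame G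
  -- the closed interval `R = [[0,1]¹, P]`
  set R : KZ.IntegralRep 1 := KZ.IntegralRep.tameCube (fun z : Fin 1 → ℝ => (aeval z P : ℝ)) hfa hfs
    with hR
  -- the base constant `c = G(1) − G(0)` is real-algebraic
  set c : ℝ := (aeval (fun _ : Fin 1 => (1 : ℝ)) G : ℝ) - aeval (fun _ : Fin 1 => (0 : ℝ)) G with hc
  have hca : IsAlgebraic ℚ c :=
    (hFs.isAlgebraic_apply (IntervalPoly.const_mem_cube zero_le_one le_rfl)
      fun _ => isAlgebraic_one).sub
      (hFs.isAlgebraic_apply (IntervalPoly.const_mem_cube le_rfl zero_le_one)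
        fun _ => isAlgebraic_zero)
  have h0a : AnalyticOnNhd ℝ (fun _ : Fin 0 → ℝ => c) (KZ.cube 0) := fun _ _ => analyticAt_const
  have h0s : IsSemialgebraicFunOn ℚ (KZ.cube 0) (fun _ : Fin 0 → ℝ => c) :=
    isSemialgebraicFunOn_const_of_isAlgebraic KZ.isSemialgebraic_cube hca
  -- the point `r₀ = [[0,1]⁰, c]`
  set r₀ : KZ.IntegralRep 0 := KZ.IntegralRep.tameCube (fun _ : Fin 0 → ℝ => c) h0a h0s with hr₀
  refine ⟨r₀, ?_, ?_⟩
  · rw [hr₀, KZ.IntegralRep.tameCube_domain, KZ.cube_zero]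
  -- over the point `ℝ⁰`, `Fin.snoc x s` is the constant tuple `s`
  have hsnoc : ∀ (x : Fin 0 → ℝ) (s : ℝ), (Fin.snoc x s : Fin 1 → ℝ) = fun _ => s :=
    fun x s => funext fun i => by rw [Fin.eq_zero i]; rfl
  -- one Newton–Leibniz move along the only coordinate, primitive `G`
  have hst : KZ.of R - KZ.of r₀ ∈ KZ.relations := by
    refine KZ.cubicalStokesGens_subset_relations (KZ.mem_cubicalStokesGens
      (F := fun z : Fin 1 → ℝ => (aeval z G : ℝ))
      (KZ.IntegralRep.isTameCube_tameCube _ _ _) (KZ.IntegralRep.isTameCube_tameCube _ _ _) hFa hFs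
      (fun x _ t _ => ?_) (fun x _ => ?_))
    · have hfun : (fun s : ℝ => (aeval (Fin.snoc x s : Fin 1 → ℝ) G : ℝ)) =
          fun s => (aeval (fun _ : Fin 1 => s) G : ℝ) := by
        funext s
        rw [hsnoc]
      rw [hfun, hR, KZ.IntegralRep.tameCube_integrand, hsnoc, ← hG]
      exact IntervalPoly.hasDerivAt_aeval_const G t
    · rw [hr₀, KZ.IntegralRep.tameCube_integrand, hsnoc, hsnoc]
  -- open versus closed interval
  have hoc : KZ.of R - KZ.of ρ ∈ KZ.relations :=
    TateFamilyKernel.of_sub_of_mem_relations_of_domain_eq_cube R ρ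
      (KZ.IntegralRep.tameCube_domain _ _ _) hd hi
  have : KZ.of ρ - KZ.of r₀ = (KZ.of R - KZ.of r₀) - (KZ.of R - KZ.of ρ) := by abel
  rw [this]
  exact KZ.relations.sub_mem hst hoc

end Summit.KontsevichZagierPeriods.InverseLandau

end
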